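import Literature.Analysis.FluidPDE.AdaptedBackwardKernel
import Literature.Analysis.FluidPDE.DriftHeatGaussianBounds

/-!
# Crux `AdaptedKernelExists` (stmt-NavierStokesRegularity-2956), line `nash-entropy-last-block`:
  the GAUSSIAN ENVELOPE for STUB `stub_kernelPackaging`

Helper file (lands `--supports stmt-NavierStokesRegularity-2956`) for the registered stub
`stub_kernelPackaging` of the line's skeleton (packaging a smooth positive classical solution `g`
of the backward equation `∂ₜg + b·∇g + νΔg = 0`, equal to the backward heat kernel
`Γ = backwardHeatKernel ν T x₀` near the pole, into an adapted backward kernel). This file is the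
Gaussian algebra of the ENVELOPE: from the comparison
`g(t, x) ≤ ∫ Γ(Ta, z) k₊(σ, x − z) dz + δ` (`k₊ = driftKernel 1 (B/ν)`, `σ ∈ (ν(Ta−t), 2ν(Ta−t)]`)
on `Ioo ta Ta` and `g = Γ` on `Ico Ta T` one gets `g ≤ K₁ Γ₄` on `Ioo ta T`, `Γ₄` the backward
heat kernel of diffusivity `4ν`:

* `kernelPackaging_rpow_norm`, `kernelPackaging_heatKernel_le_rpow_mul`: the heat kernel is
  monotone in the variance up to the factor `(s'/s)^{3/2}`;
* `kernelPackaging_integral_heatKernel_mul_heatKernel`: the semigroup law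
  `∫ G_p(z − x₀) G_q(x − z) dz = G_{p+q}(x − x₀)` (tree: `heatKernel_convolution_heatKernel_holds`);
* `kernelPackaging_driftKernel_le`: `k₊(σ, y) ≤ e^{4A²σ + 9A√σ} 2^{3/2} G_{2σ}(y)`
  (tree: `driftKernel_le_kSupTail`);
* `kernelPackaging_envelope_heat`: `g ≤ K₁ Γ₄` on `Ioo ta T`; `kernelPackaging_integrable_of_le`:
  a continuous `0 ≤ f ≤ K₁ Γ(t)` is integrable with `∫ f ≤ K₁`;
* `stub_kernelPackaging_envelope` (registered sub-goal): the envelope in the form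
  `g ≤ K (T−t)^{-3/2} e^{−‖x−x₀‖²/(16ν(T−t))}`.
-/

noncomputable section

open MeasureTheory Set Filter Topology Metric Function Real
open scoped Laplacian ContDiff Convolution
open Literature.Analysis.FluidPDE Literature.Analysis

namespace Summit.NavierStokesRegularity.NavierStokesRegularity.Theorems.AdaptedKernelExists.NashEntropyLastBlock

/-! ### Heat-kernel algebra on `ℝ³` -/

/-- The normalisations of the heat kernel at two ages: `(4πs)^{-3/2} = (s'/s)^{3/2} (4πs')^{-3/2}`. -/
theorem kernelPackaging_rpow_norm {s s' : ℝ} (hs : 0 < s) (hs' : 0 < s') :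
    (4 * π * s) ^ (-(3:ℝ) / 2) = (s' / s) ^ ((3:ℝ) / 2) * (4 * π * s') ^ (-(3:ℝ) / 2) := by
  rw [show (-(3:ℝ) / 2) = -((3:ℝ) / 2) by ring, Real.rpow_neg (by positivity),
    Real.rpow_neg (by positivity), ← Real.inv_rpow (by positivity), ← Real.inv_rpow (by positivity),
    ← Real.mul_rpow (by positivity) (by positivity)]
  congr 1
  field_simp

/-- **The heat kernel is monotone in the variance up to a power of the ratio**:
`G_s(y) ≤ (s'/s)^{3/2} G_{s'}(y)` for `0 < s ≤ s'` on `ℝ³`. -/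
theorem kernelPackaging_heatKernel_le_rpow_mul {s s' : ℝ} (hs : 0 < s) (hss' : s ≤ s')
    (y : EuclideanSpace ℝ (Fin 3)) :
    UnboundedOperators.heatKernel s y ≤
      (s' / s) ^ ((3:ℝ) / 2) * UnboundedOperators.heatKernel s' y := by
  have hs' : 0 < s' := hs.trans_le hss'
  simp only [UnboundedOperators.heatKernel, finrank_euclideanSpace_fin, Nat.cast_ofNat]
  rw [kernelPackaging_rpow_norm hs hs', mul_assoc]
  refine mul_le_mul_of_nonneg_left (mul_le_mul_of_nonneg_left (Real.exp_le_exp.2 ?_)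
    (by positivity)) (by positivity)
  rw [neg_div, neg_div, neg_le_neg_iff]
  exact div_le_div_of_nonneg_left (sq_nonneg _) (by positivity) (by linarith)

/-- **Semigroup law, shifted form**: `∫ G_p(z − x₀) G_q(x − z) dz = G_{p+q}(x − x₀)` for
`0 < p, q` (the tree's `heatKernel_convolution_heatKernel_holds` and translation invariance). -/
theorem kernelPackaging_integral_heatKernel_mul_heatKernel {p q : ℝ} (hp : 0 < p) (hq : 0 < q)
    (x x₀ : EuclideanSpace ℝ (Fin 3)) :
    ∫ z, UnboundedOperators.heatKernel p (z - x₀) * UnboundedOperators.heatKernel q (x - z) =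
      UnboundedOperators.heatKernel (p + q) (x - x₀) := by
  have h := congrFun (UnboundedOperators.heatKernel_convolution_heatKernel_holds
    (E := EuclideanSpace ℝ (Fin 3)) hp hq) (x - x₀)
  rw [convolution_def] at h
  simp only [ContinuousLinearMap.lsmul_apply, smul_eq_mul] at h
  rw [← h, ← integral_sub_right_eq_self (fun y => UnboundedOperators.heatKernel p y *
    UnboundedOperators.heatKernel q (x - x₀ - y)) x₀]
  refine integral_congr_ae (Eventually.of_forall fun z => ?_)
  simp only [sub_sub_sub_cancel_right]

/-- **The supersolution kernel under a heat kernel of doubled age**: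
`k₊(σ, y) = driftKernel 1 A σ y ≤ e^{4A²σ + 9A√σ} · 2^{3/2} G_{2σ}(y)` on `ℝ³`
(`driftKernel_le_kSupTail` at radius `‖y‖`: `(4πσ)^{-3/2} e^{−‖y‖²/(8σ)} = 2^{3/2} G_{2σ}(y)`). -/
theorem kernelPackaging_driftKernel_le {A σ : ℝ} (hA : 0 ≤ A) (hσ : 0 < σ)
    (y : EuclideanSpace ℝ (Fin 3)) :
    driftKernel 1 A σ y ≤ Real.exp (4 * A ^ 2 * σ + 9 * A * Real.sqrt σ) *
      ((2:ℝ) ^ ((3:ℝ) / 2) * UnboundedOperators.heatKernel (2 * σ) y) := by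
  have h1 := driftKernel_le_kSupTail (E := EuclideanSpace ℝ (Fin 3)) (ε := 1) (A := A)
    (by norm_num) hA hσ (norm_nonneg y) le_rfl
  simp only [finrank_euclideanSpace_fin, Nat.cast_ofNat] at h1
  rw [kSupTail] at h1
  have key : (4 * π * σ) ^ (-3 / 2 : ℝ) * Real.exp (-‖y‖ ^ 2 / (8 * σ)) =
      (2:ℝ) ^ ((3:ℝ) / 2) * UnboundedOperators.heatKernel (2 * σ) y := by
    simp only [UnboundedOperators.heatKernel, finrank_euclideanSpace_fin, Nat.cast_ofNat]
    rw [show (-3 / 2 : ℝ) = -(3:ℝ) / 2 by norm_num, kernelPackaging_rpow_norm hσ (by positivity : 0 < 2 * σ),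
      show (2 * σ / σ) = (2:ℝ) by field_simp, show (4 : ℝ) * (2 * σ) = 8 * σ by ring, mul_assoc]
  have htilt : 2 * A ^ 2 * σ + A * Real.sqrt σ + (2 * (3 + 1) * A * Real.sqrt σ + 2 * A ^ 2 * σ) =
      4 * A ^ 2 * σ + 9 * A * Real.sqrt σ := by ring
  calc driftKernel 1 A σ y
      ≤ (4 * π * σ) ^ (-3 / 2 : ℝ) * Real.exp (-‖y‖ ^ 2 / (8 * σ)) *
          Real.exp (2 * A ^ 2 * σ + A * Real.sqrt σ +
            (2 * (3 + 1) * A * Real.sqrt σ + 2 * A ^ 2 * σ)) := h1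
    _ = _ := by rw [key, htilt, mul_comm]

/-- The tilt factor is monotone in the age: `e^{4A²σ + 9A√σ} ≤ e^{4A²σ' + 9A√σ'}` for
`σ ≤ σ'`, `A ≥ 0`. -/
theorem kernelPackaging_tilt_mono {A σ σ' : ℝ} (hA : 0 ≤ A) (hσ : 0 ≤ σ) (hσσ' : σ ≤ σ') :
    Real.exp (4 * A ^ 2 * σ + 9 * A * Real.sqrt σ) ≤
      Real.exp (4 * A ^ 2 * σ' + 9 * A * Real.sqrt σ') := by
  refine Real.exp_le_exp.2 ?_
  have h1 : Real.sqrt σ ≤ Real.sqrt σ' := Real.sqrt_le_sqrt hσσ'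
  have hσ'0 : 0 ≤ σ' := hσ.trans hσσ'
  nlinarith [mul_le_mul_of_nonneg_left h1 hA, mul_le_mul_of_nonneg_left hσσ' (sq_nonneg A)]

/-! ### Integrability against the backward heat kernel -/

/-- The slices of the backward heat kernel are integrable (`t < T`, `ν > 0`). -/
theorem kernelPackaging_integrable_backwardHeatKernel {ν : ℝ} (hν : 0 < ν) (T : ℝ)
    (x₀ : EuclideanSpace ℝ (Fin 3)) {t : ℝ} (ht : t < T) :
    Integrable (backwardHeatKernel ν T x₀ t) :=
  (isAdaptedBackwardKernel_backwardHeatKernel hν T x₀).integrable ht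

/-- A continuous function with `0 ≤ f ≤ K₁ Γ(t, ·)` (`Γ` a backward heat kernel, `t < T`) is
integrable with `∫ f ≤ K₁`. -/
theorem kernelPackaging_integrable_of_le {ν T t K₁ : ℝ} {x₀ : EuclideanSpace ℝ (Fin 3)}
    {f : EuclideanSpace ℝ (Fin 3) → ℝ} (hν : 0 < ν) (ht : t < T) (hf : Continuous f)
    (hf0 : ∀ x, 0 ≤ f x) (hle : ∀ x, f x ≤ K₁ * backwardHeatKernel ν T x₀ t x) :
    Integrable f ∧ ∫ x, f x ≤ K₁ := by
  have hI : Integrable fun x => K₁ * backwardHeatKernel ν T x₀ t x :=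
    (kernelPackaging_integrable_backwardHeatKernel hν T x₀ ht).const_mul K₁
  have hfi : Integrable f := hI.mono' hf.aestronglyMeasurable
    (Eventually.of_forall fun x => by rw [Real.norm_of_nonneg (hf0 x)]; exact hle x)
  refine ⟨hfi, ?_⟩
  calc ∫ x, f x ≤ ∫ x, K₁ * backwardHeatKernel ν T x₀ t x := integral_mono hfi hI hle
    _ = K₁ := by rw [integral_const_mul, integral_backwardHeatKernel hν x₀ ht, mul_one]

/-! ### The envelope -/

/-- **Gaussian envelope, heat-kernel form.** If `g = Γ` on `Ico Ta T` and `g` obeys the upper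
comparison `g(t, x) ≤ ∫ Γ(Ta, z) k₊(ν(Ta−t) + σ₀, x − z) dz + δ` (`σ₀ ∈ (0, ν(Ta−t)]`, every
`δ > 0`) on `Ioo ta Ta`, then `g ≤ K₁ Γ₄` on `Ioo ta T`, where `Γ₄ = backwardHeatKernel (4ν) T x₀`
and `K₁ = e^{4A²σₘ + 9A√σₘ} 2^{3/2} 4^{3/2}`, `A = B/ν`, `σₘ = 2ν(Ta − ta)`. Proof: the kernel
bound `kernelPackaging_driftKernel_le`, the semigroup law (`Γ(Ta) ⋆ G_{2σ} = G_{ν(T−Ta)+2σ}`),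
`ν(T−t) ≤ ν(T−Ta) + 2σ ≤ 4ν(T−t)` and `kernelPackaging_heatKernel_le_rpow_mul`; `δ → 0`. -/
theorem kernelPackaging_envelope_heat {ν ta Ta T B : ℝ} {x₀ : EuclideanSpace ℝ (Fin 3)}
    {g : ℝ → EuclideanSpace ℝ (Fin 3) → ℝ} (hν : 0 < ν) (hta : ta < Ta) (hTa : Ta < T) (hB : 0 ≤ B)
    (hΓ : ∀ t ∈ Ico Ta T, g t = backwardHeatKernel ν T x₀ t)
    (hcomp : ∀ t ∈ Ioo ta Ta, ∀ x, ∀ δ : ℝ, 0 < δ → ∃ σ₀ : ℝ, 0 < σ₀ ∧ σ₀ ≤ ν * (Ta - t) ∧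
      g t x ≤ (∫ z, backwardHeatKernel ν T x₀ Ta z *
        driftKernel 1 (B / ν) (ν * (Ta - t) + σ₀) (x - z)) + δ) :
    ∃ K₁ : ℝ, 0 ≤ K₁ ∧ ∀ t ∈ Ioo ta T, ∀ x,
      g t x ≤ K₁ * backwardHeatKernel (4 * ν) T x₀ t x := by
  obtain ⟨A, hA⟩ : ∃ A : ℝ, A = B / ν := ⟨_, rfl⟩
  have hA0 : 0 ≤ A := by rw [hA]; positivity
  obtain ⟨σm, hσm⟩ : ∃ σm : ℝ, σm = 2 * (ν * (Ta - ta)) := ⟨_, rfl⟩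
  have hTata : 0 < Ta - ta := sub_pos.2 hta
  have hσm0 : 0 ≤ σm := by rw [hσm]; positivity
  obtain ⟨K₁, hK₁⟩ : ∃ K₁ : ℝ, K₁ = Real.exp (4 * A ^ 2 * σm + 9 * A * Real.sqrt σm) *
      (2:ℝ) ^ ((3:ℝ) / 2) * (4:ℝ) ^ ((3:ℝ) / 2) := ⟨_, rfl⟩
  have hK₁0 : 0 ≤ K₁ := by rw [hK₁]; positivity
  refine ⟨K₁, hK₁0, fun t ht x => ?_⟩
  have hTt : 0 < T - t := sub_pos.2 ht.2
  rcases lt_or_ge t Ta with htT | htT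
  · -- interior times: the comparison
    refine le_of_forall_pos_le_add fun δ hδ => ?_
    obtain ⟨σ₀, hσ₀, hσ₀le, hle⟩ := hcomp t ⟨ht.1, htT⟩ x δ hδ
    rw [← hA] at hle
    have hTat : 0 < Ta - t := sub_pos.2 htT
    have hTTa : 0 < T - Ta := sub_pos.2 hTa
    obtain ⟨σ, hσ⟩ : ∃ σ : ℝ, σ = ν * (Ta - t) + σ₀ := ⟨_, rfl⟩
    obtain ⟨p, hp⟩ : ∃ p : ℝ, p = ν * (T - Ta) := ⟨_, rfl⟩
    have hp0 : 0 < p := by rw [hp]; positivity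
    have hσ0 : 0 < σ := by rw [hσ]; positivity
    have hσle : σ ≤ σm := by
      rw [hσ, hσm]
      nlinarith [mul_le_mul_of_nonneg_left (show Ta - t ≤ Ta - ta by linarith [ht.1]) hν.le]
    rw [← hσ] at hle
    obtain ⟨C, hC⟩ : ∃ C : ℝ, C = Real.exp (4 * A ^ 2 * σm + 9 * A * Real.sqrt σm) *
        (2:ℝ) ^ ((3:ℝ) / 2) := ⟨_, rfl⟩
    have hC0 : 0 ≤ C := by rw [hC]; positivity
    -- pointwise bound of the integrand
    have hΓTa : ∀ z, backwardHeatKernel ν T x₀ Ta z = UnboundedOperators.heatKernel p (z - x₀) := by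
      intro z; rw [hp]; rfl
    have hpt : ∀ z, backwardHeatKernel ν T x₀ Ta z * driftKernel 1 A σ (x - z) ≤
        C * (UnboundedOperators.heatKernel p (z - x₀) *
          UnboundedOperators.heatKernel (2 * σ) (x - z)) := by
      intro z
      have hk := (kernelPackaging_driftKernel_le hA0 hσ0 (x - z)).trans
        (mul_le_mul_of_nonneg_right (kernelPackaging_tilt_mono hA0 hσ0.le hσle)
          (mul_nonneg (by positivity) (UnboundedOperators.heatKernel_pos (by positivity) _).le))
      rw [hΓTa z]
      calc UnboundedOperators.heatKernel p (z - x₀) * driftKernel 1 A σ (x - z)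
          ≤ UnboundedOperators.heatKernel p (z - x₀) *
              (Real.exp (4 * A ^ 2 * σm + 9 * A * Real.sqrt σm) *
                ((2:ℝ) ^ ((3:ℝ) / 2) * UnboundedOperators.heatKernel (2 * σ) (x - z))) :=
            mul_le_mul_of_nonneg_left hk (UnboundedOperators.heatKernel_pos hp0 _).le
        _ = _ := by rw [hC]; ring
    -- integrability of the majorant
    have hmaj : Integrable fun z => C * (UnboundedOperators.heatKernel p (z - x₀) *
        UnboundedOperators.heatKernel (2 * σ) (x - z)) := by
      refine Integrable.const_mul ?_ C
      have h1 : Integrable fun z : EuclideanSpace ℝ (Fin 3) =>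
          UnboundedOperators.heatKernel p (z - x₀) :=
        (UnboundedOperators.integrable_heatKernel_holds hp0).comp_sub_right x₀
      have h2 : Continuous fun z : EuclideanSpace ℝ (Fin 3) =>
          UnboundedOperators.heatKernel (2 * σ) (x - z) :=
        (UnboundedOperators.continuous_heatKernel _).comp (continuous_const.sub continuous_id)
      refine h1.mul_bdd (c := (4 * π * (2 * σ)) ^ (-((Module.finrank ℝ
        (EuclideanSpace ℝ (Fin 3)) : ℝ)) / 2)) h2.aestronglyMeasurable
        (Eventually.of_forall fun z => ?_)
      rw [Real.norm_of_nonneg (UnboundedOperators.heatKernel_pos (by positivity) _).le]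
      exact UnboundedOperators.heatKernel_le (by positivity) _
    -- the convolution
    have hI : ∫ z, backwardHeatKernel ν T x₀ Ta z * driftKernel 1 A σ (x - z) ≤
        C * UnboundedOperators.heatKernel (p + 2 * σ) (x - x₀) := by
      calc ∫ z, backwardHeatKernel ν T x₀ Ta z * driftKernel 1 A σ (x - z)
          ≤ ∫ z, C * (UnboundedOperators.heatKernel p (z - x₀) *
              UnboundedOperators.heatKernel (2 * σ) (x - z)) :=
            integral_mono_of_nonneg (Eventually.of_forall fun z => mul_nonneg
              (by rw [hΓTa z]; exact (UnboundedOperators.heatKernel_pos hp0 _).le)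
              (driftKernel_pos 1 A hσ0 _).le) hmaj (Eventually.of_forall hpt)
        _ = C * UnboundedOperators.heatKernel (p + 2 * σ) (x - x₀) := by
            rw [integral_const_mul, kernelPackaging_integral_heatKernel_mul_heatKernel hp0
              (by positivity) x x₀]
    -- comparison of ages
    have hlow : 0 < p + 2 * σ := by positivity
    have hup : p + 2 * σ ≤ 4 * ν * (T - t) := by
      rw [hp, hσ]
      nlinarith [mul_le_mul_of_nonneg_left hσ₀le hν.le, hν, hTTa, hTat]
    have hratio : 4 * ν * (T - t) / (p + 2 * σ) ≤ 4 := by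
      rw [div_le_iff₀ hlow, hp, hσ]
      nlinarith [hν, hTTa, hTat, hσ₀]
    have hheat : UnboundedOperators.heatKernel (p + 2 * σ) (x - x₀) ≤
        (4:ℝ) ^ ((3:ℝ) / 2) * UnboundedOperators.heatKernel (4 * ν * (T - t)) (x - x₀) := by
      refine (kernelPackaging_heatKernel_le_rpow_mul hlow hup (x - x₀)).trans
        (mul_le_mul_of_nonneg_right ?_ (UnboundedOperators.heatKernel_pos (by positivity) _).le)
      exact Real.rpow_le_rpow (by positivity) hratio (by norm_num)
    have hΓ4 : backwardHeatKernel (4 * ν) T x₀ t x =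
        UnboundedOperators.heatKernel (4 * ν * (T - t)) (x - x₀) := rfl
    calc g t x ≤ (∫ z, backwardHeatKernel ν T x₀ Ta z * driftKernel 1 A σ (x - z)) + δ := hle
      _ ≤ C * UnboundedOperators.heatKernel (p + 2 * σ) (x - x₀) + δ := by linarith [hI]
      _ ≤ C * ((4:ℝ) ^ ((3:ℝ) / 2) *
            UnboundedOperators.heatKernel (4 * ν * (T - t)) (x - x₀)) + δ := by
          gcongr
      _ = K₁ * backwardHeatKernel (4 * ν) T x₀ t x + δ := by rw [hΓ4, hK₁, hC]; ring
  · -- near the pole: `g = Γ`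
    have hgt : g t x = backwardHeatKernel ν T x₀ t x := by rw [hΓ t ⟨htT, ht.2⟩]
    rw [hgt]
    change UnboundedOperators.heatKernel (ν * (T - t)) (x - x₀) ≤
      K₁ * UnboundedOperators.heatKernel (4 * ν * (T - t)) (x - x₀)
    have h4 : 4 * ν * (T - t) / (ν * (T - t)) = 4 := by
      field_simp
    have h1 := kernelPackaging_heatKernel_le_rpow_mul (s := ν * (T - t)) (s' := 4 * ν * (T - t))
      (by positivity) (by nlinarith) (x - x₀)
    rw [h4] at h1
    refine h1.trans (mul_le_mul_of_nonneg_right ?_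
      (UnboundedOperators.heatKernel_pos (by positivity) _).le)
    rw [hK₁]
    refine le_mul_of_one_le_left (by positivity) (one_le_mul_of_one_le_of_one_le ?_ ?_)
    · exact Real.one_le_exp (by positivity)
    · exact Real.one_le_rpow (by norm_num) (by norm_num)

/-- **Registered sub-goal `stub_kernelPackaging_envelope`** (the envelope half of STUB
`stub_kernelPackaging`): under `g = Γ` on `Ico Ta T` and the upper comparison on `Ioo ta Ta`,
`g(t, x) ≤ K (T−t)^{-3/2} e^{−‖x−x₀‖²/(a(T−t))}` on `Ioo ta T` for some `K` and `a > 0`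
(`a = 16ν`; `kernelPackaging_envelope_heat` and `backwardHeatKernel_eq`). -/
theorem stub_kernelPackaging_envelope :
    ∀ (ν ta Ta T B : ℝ) (x₀ : EuclideanSpace ℝ (Fin 3)) (g : ℝ → EuclideanSpace ℝ (Fin 3) → ℝ), 0 < ν → ta < Ta → Ta < T → 0 ≤ B → (∀ t ∈ Ico Ta T, g t = backwardHeatKernel ν T x₀ t) → (∀ t ∈ Ioo ta Ta, ∀ x, ∀ δ : ℝ, 0 < δ → ∃ σ₀ : ℝ, 0 < σ₀ ∧ σ₀ ≤ ν * (Ta - t) ∧ g t x ≤ (∫ z, backwardHeatKernel ν T x₀ Ta z * driftKernel 1 (B / ν) (ν * (Ta - t) + σ₀) (x - z)) + δ) → ∃ K a : ℝ, 0 < a ∧ ∀ t ∈ Ioo ta T, ∀ x, g t x ≤ K * (T - t) ^ (-(3:ℝ) / 2) * Real.exp (-(‖x - x₀‖ ^ 2) / (a * (T - t))) := by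
  intro ν ta Ta T B x₀ g hν hta hTa hB hΓ hcomp
  obtain ⟨K₁, -, hle⟩ := kernelPackaging_envelope_heat hν hta hTa hB hΓ hcomp
  refine ⟨K₁ * (4 * π * (4 * ν)) ^ (-(3:ℝ) / 2), 16 * ν, by positivity, fun t ht x => ?_⟩
  have h := hle t ht x
  rw [backwardHeatKernel_eq (by positivity : (0:ℝ) ≤ 4 * ν) x₀ ht.2 x] at h
  simp only [finrank_euclideanSpace_fin, Nat.cast_ofNat] at h
  have e : (4:ℝ) * (4 * ν) * (T - t) = 16 * ν * (T - t) := by ring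
  rw [e] at h
  calc g t x ≤ _ := h
    _ = _ := by ring

end Summit.NavierStokesRegularity.NavierStokesRegularity.Theorems.AdaptedKernelExists.NashEntropyLastBlock

end
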